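import Literature.RepresentationTheory.MoeglinVignerasWaldspurger1987.RankOneThetaCharacterRatio
import HarnessLib

/-!
# The `(U(1), U(1))` character relation PINS its character: two characters `θ, θ′` of `U(J₁)(F_v)` with
# `tr ω₂ = -θ · tr ω₁` AND `tr ω₂ = -θ′ · tr ω₁` off `{±1}` are equal

[MoeglinVignerasWaldspurger1987] C. Mœglin, M.-F. Vignéras, J.-L. Waldspurger, LNM 1291 (1987), Chap. 3 §IV (theta dichotomy for unitary dual
pairs over a `p`-adic field), rank `1 × 1`; [Weil1964] Chap. I n° 14.  Topic `RepresentationTheory/MoeglinVignerasWaldspurger1987`; namespace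
`Literature.RepresentationTheory.MoeglinVignerasWaldspurger1987`.  THEOREMS ONLY (no definition, no named fact, no `sorry`, no instance, no
notation).  Cell `hodgecm-mathlib`, half A line LD2 (dealer LD2-plan (g2), DEALS #1∕#1b 2026-09-02), seat LD2-p02 (g2); `--supports
stmt-HodgeConjecture-24832`; count-neutral.

WHY.  ★ `rankOne_theta_character_ratio` (and hence ★ `rankOne_theta_dichotomy`, ★ `rankOne_theta_anisotropicPlane_dichotomy`, whose vanishing
centre character is `χ₀ = θ⁻¹`) produce the dichotomy character `θ` EXISTENTIALLY (Weil's extension trick on `−Φ₂∕Φ₁`).  The in-house payment of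
the PIN «`χ̌₀ = μ_v²`» ([Liu2021, Lem. D.1 (1)]; road of record A-p19 (g30) CENSUS-L1-pin §2–§3, LD2-plan (g2) DEALS #1b) computes the two big-cell
scalars `λ₁, λ₂` of the CM sections and so exhibits an EXPLICIT character `θ′` satisfying the SAME trace relation; this file is the step «REL pins θ»
that turns such a `θ′` into `θ = θ′` (and `χ₀ = θ′⁻¹`).

* §1 `rankOne_trace_fixedPoints_ne_zero` — the finite-level character of `ω_{s₁}` does not vanish near a regular point: for `z₀² ≠ 1` there is an
  open `K₀` with `tr(ω_{s₁}(z₀ k) | 𝒮^L) ≠ 0` for all `k ∈ K₀` and open `L ≤ K₀` (★ `rankOne_trace_fixedPoints_eq`: the trace is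
  `λ · |β|_v^{−1∕2} · g_ψ(β⁻¹(1 − a))` with `λ ∈ ℂˣ` the big-cell scalar (★ `rankOne_exists_scalar_bigCellWord`), `β ≠ 0`, and
  `g_ψ ≠ 0` ★ `weilGauss_ne_zero` since `1 − a ≠ 0` by `a² − d b² = 1`, `b ≠ 0`).
* §2 `eq_of_rankOne_character_relation` — if `θ` and `θ′` both satisfy the conclusion of ★ `rankOne_theta_character_ratio` VERBATIM (for the same
  `s₁` and any second family of operators `s₂`), then `θ = θ′`: at a regular `z` both relations and §1 give `θ z = θ′ z`; the two exceptional points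
  `1`, `−1` are products of two regular elements of the INFINITE torus (★ `infinite_localPi_rankOne`).

HONEST LABEL: HC_CM is proved only modulo the 7 printed citations (2 remaining: hLiu418 = stmt-HodgeConjecture-24832, h413 = stmt-HodgeConjecture-24833)
until rung 0 closes; this file asserts nothing of print and moves no digit.

## References
* [MoeglinVignerasWaldspurger1987] LNM 1291 (1987), Chap. 2 II.1 (A), II.8; Chap. 3 §IV.4 Théorème principal.
* [Weil1964] A. Weil, Acta Math. 111 (1964) 143–211, Chap. I n° 13 (16) p. 160, n° 14.
* [PlatonovRapinchuk1994] V. Platonov, A. Rapinchuk, *Algebraic groups and number theory*, §6.2.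
-/

set_option autoImplicit false

noncomputable section

open NumberField IsDedekindDomain Matrix MeasureTheory
open scoped Matrix MatrixGroups NNReal Topology
open Literature.RepresentationTheory Literature.RepresentationTheory.HeisenbergGroup
open Literature.RepresentationTheory.TwistedCoinv
open Literature.NumberTheory.GelbartRogawski1991.UnitaryDualPair.LocalSplitting
open Literature.NumberTheory.Automorphic Literature.NumberTheory.Automorphic.UnitaryGroup
open Literature.NumberTheory.Automorphic.Liu2021
open Literature.NumberTheory.GaloisRepresentations.IsNonarchimedeanLocalField
open Literature.NumberTheory.Weil1964 Literature.NumberTheory.QuadraticForms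

namespace Literature.RepresentationTheory.MoeglinVignerasWaldspurger1987

section Unique

variable (F : Type) [Field F] [NumberField F] (E : Type) [Field E] [NumberField E] [Algebra F E]
  [Algebra.IsQuadraticExtension F E] (c : E ≃ₐ[F] E) (δ : E) (hcδ : c δ = -δ) (hδ : δ ≠ 0) (d : F)
  (hd : δ * δ = algebraMap F E d) (t : Matrix (Fin 1) (Fin 1) F) (ht : t.IsSymm) (htd : IsUnit t.det)
  (J₁ : Matrix (Fin 1) (Fin 1) E) (hJ₁ : J₁ = t.map (algebraMap F E)) (v : HeightOneSpectrum (𝓞 F))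
  (hE : IsField (UnitaryGroup.LocalRing E v))
  (s₁ : localPi E c 1 J₁ v →* LocalMp F 1 t v)
  (hs₁ : ∀ g, MpPsi.proj _ (s₁ g) = iota F E c 1 hcδ hδ hd t ht hJ₁ v g)
  (hsm₁ : Representation.IsSmooth ((MpPsi.toRep (localSchrodinger F 1 t v)).comp s₁))
  (s₂ : localPi E c 1 J₁ v →* LocalMp F 1 t v)

/-! ## §1 The character of `ω_{s₁}` does not vanish near a regular point -/

include hcδ hδ hd ht htd hJ₁ hE hs₁ hsm₁ in
set_option maxHeartbeats 1600000 in -- as ★ `rankOne_torusTrace_eq_explicit`: 25-binder statements over the big-cell operator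
/-- **Non-vanishing of the finite-level character near a regular point**: for `z₀ ∈ U(J₁)(F_v)` with `z₀² ≠ 1` there is an open subgroup `K₀`
such that `tr(ω_{s₁}(z₀ k) | 𝒮^L) ≠ 0` for every `k ∈ K₀` and every open subgroup `L ≤ K₀` — the explicit value
`λ · |β|_v^{−1∕2} · g_{ψ_v}(β⁻¹(1 − a))` of ★ `rankOne_trace_fixedPoints_eq` has three non-zero factors (`λ ∈ ℂˣ`; `β = d b τ⁻¹ ≠ 0`; `1 − a ≠ 0` since
`a² − d b² = 1` and `b ≠ 0`, so ★ `weilGauss_ne_zero`). [cite: Weil1964, Chap. I n° 13 (16) p. 160] [cite: MoeglinVignerasWaldspurger1987, Chap. 2 II.8] -/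
theorem rankOne_trace_fixedPoints_ne_zero (z₀ : localPi E c 1 J₁ v) (hz₀ : z₀ * z₀ ≠ 1)
    [MeasurableSpace (v.adicCompletion F)] [BorelSpace (v.adicCompletion F)]
    (μ : Measure (v.adicCompletion F)) [μ.IsAddHaarMeasure] (m : ℤ) (hm : (adeleAddCharAt F v).HasConductorExp m) :
    ∃ K₀ : Subgroup (localPi E c 1 J₁ v), IsOpen (K₀ : Set (localPi E c 1 J₁ v)) ∧
      ∀ k ∈ K₀, ∀ L : Subgroup (localPi E c 1 J₁ v), IsOpen (L : Set (localPi E c 1 J₁ v)) → L ≤ K₀ →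
        LinearMap.trace ℂ (Representation.fixedPoints ((MpPsi.toRep (localSchrodinger F 1 t v)).comp s₁) L)
            ((((MpPsi.toRep (localSchrodinger F 1 t v)).comp s₁) (z₀ * k)).restrict
              (apply_mem_fixedPoints_of_comm ((MpPsi.toRep (localSchrodinger F 1 t v)).comp s₁)
                (localPi_one_mul_comm E c J₁ v) L (z₀ * k))) ≠ 0 := by
  classical
  haveI : CharZero (v.adicCompletion F) := charZero_of_injective_algebraMap (algebraMap F _).injective
  have htwo : (2 : v.adicCompletion F) ≠ 0 := two_ne_zero
  have hψ := isContinuousNontrivial_adeleAddCharAt F v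
  have hl := isLocallyConstant_of_isContinuousNontrivial hψ
  have hJ₁' : J₁ 0 0 ≠ 0 := by
    rw [hJ₁, Matrix.map_apply, map_ne_zero_iff _ (algebraMap F E).injective, ← Matrix.det_fin_one t]; exact htd.ne_zero
  -- NB: no `obtain`∕`rcases` on the 25-binder ∃∕∧ packages (their `whnf` exhausts any budget): projections only, as in ★ `RankOneThetaCharacterRatio`
  have W := rankOne_trace_fixedPoints_eq F E c δ hcδ hδ d hd t ht htd J₁ hJ₁ v hE s₁ hs₁ hsm₁ z₀ hz₀ μ m hm
  refine ⟨W.choose, W.choose_spec.1, fun k hk L hLo hLK => ?_⟩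
  -- opaque names for the coordinates `ζ_u = a(u) + b(u) δ` (cheap to carry through the 25-binder terms)
  have exA : ∃ f : localPi E c 1 J₁ v → v.adicCompletion F, ∀ u, f u =
      QuadraticCoordinates.re (quadraticLocalEquiv E v c hcδ hδ).toLinearEquiv.toAddEquiv
        (fun w : PlacesOver E v => ((u : LocalGLPi E 1 v) w).val 0 0) := ⟨_, fun _ => rfl⟩
  have exB : ∃ f : localPi E c 1 J₁ v → v.adicCompletion F, ∀ u, f u =
      QuadraticCoordinates.im (quadraticLocalEquiv E v c hcδ hδ).toLinearEquiv.toAddEquiv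
        (fun w : PlacesOver E v => ((u : LocalGLPi E 1 v) w).val 0 0) := ⟨_, fun _ => rfl⟩
  let aOf := exA.choose
  let bOf := exB.choose
  have haOf : ∀ u, aOf u = QuadraticCoordinates.re (quadraticLocalEquiv E v c hcδ hδ).toLinearEquiv.toAddEquiv
        (fun w : PlacesOver E v => ((u : LocalGLPi E 1 v) w).val 0 0) := exA.choose_spec
  have hbOf : ∀ u, bOf u = QuadraticCoordinates.im (quadraticLocalEquiv E v c hcδ hδ).toLinearEquiv.toAddEquiv
        (fun w : PlacesOver E v => ((u : LocalGLPi E 1 v) w).val 0 0) := exB.choose_spec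
  have T := W.choose_spec.2 k hk (aOf (z₀ * k)) (bOf (z₀ * k)) (haOf _) (hbOf _)
  have hβ := T.1
  -- the norm equation `a² - d b² = 1`, hence `1 - a ≠ 0` (as `b ≠ 0`)
  have hnorm : aOf (z₀ * k) ^ 2 - (d : v.adicCompletion F) * bOf (z₀ * k) ^ 2 = 1 := by
    rw [haOf, hbOf]; exact rankOne_re_sq_sub E c J₁ v hJ₁' hcδ hδ hd (z₀ * k)
  have hd0 : (d : v.adicCompletion F) ≠ 0 := (mul_ne_zero_iff.1 (mul_ne_zero_iff.1 hβ).1).1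
  have hb0 : bOf (z₀ * k) ≠ 0 := (mul_ne_zero_iff.1 (mul_ne_zero_iff.1 hβ).1).2
  have h1a : 1 - aOf (z₀ * k) ≠ 0 := by
    intro h0
    have ha1 : aOf (z₀ * k) = 1 := by linear_combination -h0
    rw [ha1] at hnorm
    have h' : (d : v.adicCompletion F) * bOf (z₀ * k) ^ 2 = 0 := by linear_combination -hnorm
    rcases mul_eq_zero.1 h' with h'' | h''
    · exact hd0 h''
    · exact hb0 (pow_eq_zero_iff two_ne_zero |>.1 h'')
  -- the Schur scalar `λ ∈ ℂˣ` of `ω_{s₁}(z₀ k)` against the big-cell operator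
  have hB := rankOne_blockB_bijective E c hcδ hδ hd t ht htd hJ₁ v (z₀ * k) _ rfl (by rw [← hbOf]; exact hβ)
  have S := rankOne_exists_scalar_bigCellWord F E c hcδ hδ hd t ht htd hJ₁ v μ hm s₁ hs₁ (z₀ * k) _ rfl hB
  have hlam' : ∀ f : SchwartzBruhat (Fin 1 → v.adicCompletion F),
      ((MpPsi.toRep (localSchrodinger F 1 t v)).comp s₁) (z₀ * k) f =
        (S.choose : ℂ) • bigCellOp hl μ hψ hm
          (symplecticConj (gramProd (localGram F 1 t v) (UnitaryGroup.isUnit_det_map (algebraMap F (v.adicCompletion F)) htd))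
            (polar_dotProductBilin_gramProd (localGram F 1 t v) (UnitaryGroup.isUnit_det_map (algebraMap F (v.adicCompletion F)) htd))
            (iota F E c 1 hcδ hδ hd t ht hJ₁ v (z₀ * k))) f := fun f => by
    rw [bigCellOp_of_bijective hl μ hψ hm _ hB]; exact S.choose_spec f
  rw [T.2 L hLo hLK (S.choose : ℂ) hlam']
  -- three non-zero factors
  have hsqrt : ((Real.sqrt (normAbs (v.adicCompletion F)
      ((d : v.adicCompletion F) * bOf (z₀ * k) * (localGram F 1 t v 0 0)⁻¹)) : ℝ) : ℂ) ≠ 0 := by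
    refine Complex.ofReal_ne_zero.2 (Real.sqrt_pos.2 ?_).ne'
    exact NNReal.coe_pos.2 (pos_iff_ne_zero.2 ((map_ne_zero (normAbs (v.adicCompletion F))).2 hβ))
  have hgauss : weilGauss (adeleAddCharAt F v) μ
      (((d : v.adicCompletion F) * bOf (z₀ * k) * (localGram F 1 t v 0 0)⁻¹)⁻¹ * (1 - aOf (z₀ * k))) ≠ 0 :=
    weilGauss_ne_zero (ψ := adeleAddCharAt F v) (μ := μ) hψ (mul_ne_zero (inv_ne_zero hβ) h1a) htwo
  exact mul_ne_zero (mul_ne_zero (Units.ne_zero S.choose) (inv_ne_zero hsqrt)) hgauss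

/-! ## §2 The trace relation pins `θ` -/

include hcδ hδ hd ht htd hJ₁ hE hs₁ hsm₁ in
set_option maxHeartbeats 1600000 in -- two instances of the relation + §1; same budget as the ★ producer
/-- **THE CHARACTER RELATION PINS ITS CHARACTER.**  If two characters `θ`, `θ′` of the torus `U(J₁)(F_v)` (non-split place) both satisfy the
conclusion of ★ `rankOne_theta_character_ratio` VERBATIM — every `z ∉ {1, −1}` has a neighbourhood `z K₀` on which, for every open `L ≤ K₀`,
`tr(ω_{s₂}(u) | 𝒮^L) = −θ(u) · tr(ω_{s₁}(u) | 𝒮^L)` (resp. with `θ′`) — then `θ = θ′`: at a regular `z` the two relations and the non-vanishing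
§1 `rankOne_trace_fixedPoints_ne_zero` give `θ z = θ′ z`; `1` and `−1` are products `u · (u⁻¹ z)` of two regular elements, `u ∉ {1, −1}` existing because
the torus is INFINITE (★ `infinite_localPi_rankOne`).  (`s₂` may be any family of operators; only `ω_{s₁}`'s non-vanishing is used.)
[cite: MoeglinVignerasWaldspurger1987, Chap. 3 §IV.4 Théorème principal] [cite: Weil1964, Chap. I n° 14] -/
theorem eq_of_rankOne_character_relation [MeasurableSpace (v.adicCompletion F)] [BorelSpace (v.adicCompletion F)]
    (μ : Measure (v.adicCompletion F)) [μ.IsAddHaarMeasure] (m : ℤ) (hm : (adeleAddCharAt F v).HasConductorExp m)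
    (θ θ' : localPi E c 1 J₁ v →* ℂˣ)
    (hrel : ∀ z : localPi E c 1 J₁ v, z ≠ 1 → z ≠ localUnitScalar E c J₁ v (-1) (negOne_mul_conjLocal_negOne E c v) →
        ∃ K₀ : Subgroup (localPi E c 1 J₁ v), IsOpen (K₀ : Set (localPi E c 1 J₁ v)) ∧
          ∀ u : localPi E c 1 J₁ v, z⁻¹ * u ∈ K₀ →
            ∀ L : Subgroup (localPi E c 1 J₁ v), IsOpen (L : Set (localPi E c 1 J₁ v)) → L ≤ K₀ →
              LinearMap.trace ℂ (Representation.fixedPoints ((MpPsi.toRep (localSchrodinger F 1 t v)).comp s₂) L)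
                  ((((MpPsi.toRep (localSchrodinger F 1 t v)).comp s₂) u).restrict
                    (apply_mem_fixedPoints_of_comm ((MpPsi.toRep (localSchrodinger F 1 t v)).comp s₂)
                      (localPi_one_mul_comm E c J₁ v) L u)) =
                -((((θ u : ℂˣ) : ℂ)) *
                  LinearMap.trace ℂ (Representation.fixedPoints ((MpPsi.toRep (localSchrodinger F 1 t v)).comp s₁) L)
                    ((((MpPsi.toRep (localSchrodinger F 1 t v)).comp s₁) u).restrict
                      (apply_mem_fixedPoints_of_comm ((MpPsi.toRep (localSchrodinger F 1 t v)).comp s₁)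
                        (localPi_one_mul_comm E c J₁ v) L u))))
    (hrel' : ∀ z : localPi E c 1 J₁ v, z ≠ 1 → z ≠ localUnitScalar E c J₁ v (-1) (negOne_mul_conjLocal_negOne E c v) →
        ∃ K₀ : Subgroup (localPi E c 1 J₁ v), IsOpen (K₀ : Set (localPi E c 1 J₁ v)) ∧
          ∀ u : localPi E c 1 J₁ v, z⁻¹ * u ∈ K₀ →
            ∀ L : Subgroup (localPi E c 1 J₁ v), IsOpen (L : Set (localPi E c 1 J₁ v)) → L ≤ K₀ →
              LinearMap.trace ℂ (Representation.fixedPoints ((MpPsi.toRep (localSchrodinger F 1 t v)).comp s₂) L)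
                  ((((MpPsi.toRep (localSchrodinger F 1 t v)).comp s₂) u).restrict
                    (apply_mem_fixedPoints_of_comm ((MpPsi.toRep (localSchrodinger F 1 t v)).comp s₂)
                      (localPi_one_mul_comm E c J₁ v) L u)) =
                -((((θ' u : ℂˣ) : ℂ)) *
                  LinearMap.trace ℂ (Representation.fixedPoints ((MpPsi.toRep (localSchrodinger F 1 t v)).comp s₁) L)
                    ((((MpPsi.toRep (localSchrodinger F 1 t v)).comp s₁) u).restrict
                      (apply_mem_fixedPoints_of_comm ((MpPsi.toRep (localSchrodinger F 1 t v)).comp s₁)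
                        (localPi_one_mul_comm E c J₁ v) L u)))) :
    θ = θ' := by
  classical
  -- (1) agreement at every regular point
  have key : ∀ z : localPi E c 1 J₁ v, z ≠ 1 → z ≠ localUnitScalar E c J₁ v (-1) (negOne_mul_conjLocal_negOne E c v) →
      θ z = θ' z := by
    intro z h1 h2
    have hz : z * z ≠ 1 := fun h =>
      (rankOne_eq_one_or_eq_negOne_of_mul_self_eq_one F E c J₁ v hE z h).elim h1 h2
    obtain ⟨K₀, hK₀o, hK₀⟩ := hrel z h1 h2
    obtain ⟨K₀', hK₀'o, hK₀'⟩ := hrel' z h1 h2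
    obtain ⟨K₁, hK₁o, hK₁⟩ := rankOne_trace_fixedPoints_ne_zero F E c δ hcδ hδ d hd t ht htd J₁ hJ₁ v hE s₁ hs₁ hsm₁ z hz μ m hm
    have hLo : IsOpen ((K₀ ⊓ K₀' ⊓ K₁ : Subgroup (localPi E c 1 J₁ v)) : Set (localPi E c 1 J₁ v)) := by
      rw [Subgroup.coe_inf, Subgroup.coe_inf]
      exact (hK₀o.inter hK₀'o).inter hK₁o
    have hz1 : z⁻¹ * (z * 1) ∈ K₀ := by rw [mul_one, inv_mul_cancel]; exact K₀.one_mem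
    have hz1' : z⁻¹ * (z * 1) ∈ K₀' := by rw [mul_one, inv_mul_cancel]; exact K₀'.one_mem
    have hne := hK₁ 1 K₁.one_mem (K₀ ⊓ K₀' ⊓ K₁) hLo inf_le_right
    have e1 := hK₀ (z * 1) hz1 (K₀ ⊓ K₀' ⊓ K₁) hLo (inf_le_left.trans inf_le_left)
    have e2 := hK₀' (z * 1) hz1' (K₀ ⊓ K₀' ⊓ K₁) hLo (inf_le_left.trans inf_le_right)
    have e3 := mul_right_cancel₀ hne (neg_inj.1 (e1.symm.trans e2))
    rw [mul_one] at e3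
    exact Units.ext e3
  -- (2) the two exceptional points are products of regular elements of the infinite torus
  haveI : Infinite (localPi E c 1 J₁ v) := infinite_localPi_rankOne F E c hcδ hδ hd J₁ v
  refine MonoidHom.ext fun g => ?_
  by_cases hg1 : g = 1
  · rw [hg1, map_one, map_one]
  by_cases hg2 : g = localUnitScalar E c J₁ v (-1) (negOne_mul_conjLocal_negOne E c v)
  · obtain ⟨u, hu⟩ := Infinite.exists_notMem_finset
      ({1, localUnitScalar E c J₁ v (-1) (negOne_mul_conjLocal_negOne E c v)} : Finset (localPi E c 1 J₁ v))
    rw [Finset.mem_insert, Finset.mem_singleton, not_or] at hu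
    have hu1 : u⁻¹ * g ≠ 1 := fun h => hu.2 (by
      rw [hg2] at h
      have := congrArg (fun x => u * x) h
      simpa only [mul_inv_cancel_left, mul_one] using this.symm)
    have hu2 : u⁻¹ * g ≠ localUnitScalar E c J₁ v (-1) (negOne_mul_conjLocal_negOne E c v) := fun h => hu.1 (by
      rw [hg2] at h
      have h' := congrArg (fun x => x * (localUnitScalar E c J₁ v (-1) (negOne_mul_conjLocal_negOne E c v))⁻¹) h
      simp only [mul_assoc, mul_inv_cancel, mul_one] at h'
      exact inv_eq_one.1 h')
    calc θ g = θ (u * (u⁻¹ * g)) := by rw [mul_inv_cancel_left]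
      _ = θ u * θ (u⁻¹ * g) := map_mul θ _ _
      _ = θ' u * θ' (u⁻¹ * g) := by rw [key u hu.1 hu.2, key _ hu1 hu2]
      _ = θ' (u * (u⁻¹ * g)) := (map_mul θ' _ _).symm
      _ = θ' g := by rw [mul_inv_cancel_left]
  · exact key g hg1 hg2

end Unique

end Literature.RepresentationTheory.MoeglinVignerasWaldspurger1987

end
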